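/-
Copyright (c) 2026 the pub-hodgecm-mathlib formalisation cell (harness21).  Prover seat hodgecm-mathlib-LH4-p05 (g3), req620 Track A «(D-RAM) FOUR-FRAME» squad
(unit U3_Laws, (R-18) «K-ABS-R := NI2 ⊕ KMS»; (KMS) ROAD «MODULO κ-STAGE B», κ-Stage A bricks (Oκ2a) + (Oκ2c) = the κ-twist of ★ (O2a) p04 + ★ (O2c) p11;
dealer LH4-plan (g11) WORD #20∕#21; plan `F0/P3c/LH4/LH4-p05/g3/PLAN-KMS-modKappaStageB.v1`).  2026-09-04.
-/
import Summits.HodgeConjecture.HodgeConjecture.Theorems.F0P3cDyRamDiagonalKappaOrbitFibreCount   -- (Oκ2b) (this seat): the κ-twisted fibre identity along a unit-torus orbit; brings `…KappaCountEval`, the DEFS leaf, ★ (O2b) PARTS 1–3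
import Summits.HodgeConjecture.HodgeConjecture.Theorems.F0P3cDyRamDiagonalOrbitAveraging         -- ★ (O2c) FILE 1 p856016 (LH4-p11): §1 averaging over orbits, §2 orbit block system ∕ indices ≠ 0; brings ★ (O1), ★ (O2a)
import Summits.HodgeConjecture.HodgeConjecture.Theorems.F0P3cDyRamDiagonalOrbitFibreCountHeads   -- ★ (O2b) PART 4 p856106 (LH4-p14): `finite_unitTorus_orbit_of_mem_normalisedStableLattices`
import HarnessLib

/-!
# Crux `H413`, line LH4 «(D-RAM) FOUR-FRAME» road — unit U3_Laws (iii), (KMS) ROAD «MODULO κ-STAGE B», κ-STAGE A bricks (Oκ2a) + (Oκ2c):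
# THE κ-WEIGHTED ORBIT COUNT `Σ_{e ∈ (ℤ∕2)³} χ⁰_i(e) · #{M : M a type-tv vertex of diag(c^{e}), T·M = M} = 8 · Σᶠ_{M₀ ∈ 𝓛₀(T)} m_i(M₀) · 1∕[𝒰 : S_F(M₀)]`

Cell `hodgecm-mathlib` (D-0151), FLOOR 0, crux item H413 = `stmt-HodgeConjecture-24833`, route of record `HCCMUnconditional`; squad F0∕P3c∕LH4 (req618∕req620); registered stub served:
`F0P3cDyRamFourFrameU3.stub_U3_kappaModelSum` (KMS; tree `Cruxes/H413/Lines/F0_P3c_DyRamFourFrame_U3_Laws.lean` ED. 7 :407–:429).  THEOREMS ONLY (no `def`, no instance, no notation,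
no `sorry`, default heartbeats); lane `--supports stmt-HodgeConjecture-24833` (count-neutral).

THE MATHEMATICS (this seat's PLAN v1 §2; the (MS) route of ★ p04∕p14∕p11 with one character inserted).  The left-hand side of (KMS) :407 at type `tv` and slot `i` is
`Σ_e χ⁰_i(e)·C_tv(e)`, `C_tv(e) = #{M : M a type-tv vertex of diag(d_e), T·M = M}` (`d_e j = c` if `e j` else `1`).  (Oκ2a) §2: by ★ (O2a)'s bijection class by class and fibrewise
counting, `Σ_e χ⁰_i(e)·C_tv(e) = Σᶠ_{M₀ ∈ 𝓛₀(T)} F_i(M₀)`, `F_i(M) := Σ_e χ⁰_i(e)·#{a : diag(ϖu^{a})·M type-tv for diag(d_e)} ∈ ℚ` — a SIGNED count, so the engine of ★ (O2c)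
FILE 1 §3 is re-run for `ℚ`-valued `F` and an arbitrary per-orbit MULTIPLICITY `m : lattices → ℚ` (§1: if `(Σᶠ_{𝒯·M₀} F)·[𝒰 : S_F(M₀)] = 8·[𝒯 : S̃(M₀)]·m(M₀)` at every `M₀ ∈ 𝓛₀(T)`
then `Σᶠ_{𝓛₀(T)} F = 8·Σᶠ_{𝓛₀(T)} m·stabiliserWeight`; pure averaging over the unit-torus orbits, ★ FILE 1 §1–§2 + ★ (O1)).  (Oκ2c) §3: fed with (Oκ2b) (`m = kappaCount σ ϖ tv i`,
the signed κ-count of the DEFS leaf) this gives the heads — at general `tv` under the one-coset property at every `M₀ ∈ 𝓛₀(T)` (B9-0 shape), at `tv = 0` UNCONDITIONALLY (★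
`fibre_isCoset_zero`: on a normalised lattice the type-0 polarisations form one `S_F`-coset), with the right-hand finsum restricted to the polarisable part of `𝓛₀(T)`
(`kappaCount = 0` off it) so that it matches the κ-Stage-B currency (`{M ∈ 𝓛₀(T) | IsDualisableLattice σ ϖ M}` = the union of ★ `stratum σ ϖ T a`).  (R-21): at `tv = 2` the
one-coset property FAILS on the glued strata with `ρ` even (LH4-p09 (g2)); the type-2 head WITH MULTIPLICITY (no `hcoset`) is a separate file on top of LH4-p14's (O2b)-MULT —
§1's engine already takes an arbitrary `m`.

WHAT IS PROVED (`N = 3`, `K : Type`, `[Finite 𝓀[K]]`, `T = diag(s)` a regular unit diagonal, `|ϖ| = exp(−1)` with unit avatar `ϖu`).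
* §1 `finsum_mem_eq_eight_mul_finsum_mul_stabiliserWeight` — the SIGNED ORBIT-AVERAGING ENGINE (any `F m : lattices → ℚ`, any `σ`).
* §2 `cast_sum_signChar_mul_ncard_fixed_vertices_eq_finsum` — (Oκ2a): the (KMS) left-hand side, cast to `ℚ`, as `Σᶠ_{M₀ ∈ 𝓛₀(T)} F_i(M₀)`.
* §3 `cast_sum_signChar_mul_ncard_eq_eight_mul_finsum_kappaCount` (any `tv`, one-coset property on `𝓛₀(T)`), `…_kappaCount_zero` (`tv = 0`, unconditional, over
  `{M ∈ 𝓛₀(T) | IsDualisableLattice σ ϖ M}`) — the (Oκ2c) heads; the left-hand side is the (KMS) summand block TOKEN FOR TOKEN.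
HONEST LABEL.  Count-neutral (`--supports`); nothing printed is asserted; (KMS) stays a PROVER TARGET (empirical census law in diagonal-model currency); `HC_CM` is proved only modulo
the 7 printed citations (2 remaining named inputs: hLiu418 = `stmt-HodgeConjecture-24832`, h413 = `stmt-HodgeConjecture-24833`) until rung 0 closes.

## References
* [Kottwitz1986BaseChangeUnits] R. E. Kottwitz, *Base change for unit elements of Hecke algebras*, Compositio Math. 60 (1986), §1 pp. 240–241 (κ-orbital integrals of units as
  signed lattice counts modulo the torus: the sum over lattices modulo `T(F)` weighted by stabiliser indices and κ-signs).
* [Rogawski1990] J. D. Rogawski, *Automorphic Representations of Unitary Groups in Three Variables*, Ann. of Math. Stud. 123 (1990), §4.9 Prop. 4.9.1 (a) p. 55, §4.10 p. 58.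
* [LanglandsShelstad1987] R. P. Langlands, D. Shelstad, *On the definition of transfer factors*, Math. Ann. 278 (1987), §3.
* [Serre1980Trees] J.-P. Serre, *Trees*, Springer (1980), Ch. II §1.1 (lattices `g·𝒪^N` and the diagonal action).
-/

set_option autoImplicit false

noncomputable section

namespace Summit.HodgeConjecture.HodgeConjecture.Cruxes.H413.F0P3cDyRamDiagonalKappaOrbitCount

open Matrix
open Literature.NumberTheory.Automorphic Literature.NumberTheory.Automorphic.HermitianLattice
open Literature.NumberTheory.Automorphic.UnitaryLatticeTree Literature.NumberTheory.Automorphic.UnitaryThreeFourFrame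
open Summit.HodgeConjecture.HodgeConjecture.Cruxes.H413.F0P3cDyRamDiagonalTorusDefs
open Summit.HodgeConjecture.HodgeConjecture.Cruxes.H413.F0P3cDyRamDiagonalStrataDefs
open Summit.HodgeConjecture.HodgeConjecture.Cruxes.H413.F0P3cDyRamDiagonalUnitTorusOrbit
open Summit.HodgeConjecture.HodgeConjecture.Cruxes.H413.F0P3cDyRamDiagonalPairReindex
open Summit.HodgeConjecture.HodgeConjecture.Cruxes.H413.F0P3cDyRamDiagonalFixedFinite
open Summit.HodgeConjecture.HodgeConjecture.Cruxes.H413.F0P3cDyRamDiagonalStableLatticesFinite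
open Summit.HodgeConjecture.HodgeConjecture.Cruxes.H413.F0P3cDyRamDiagonalOrbitAveraging
open Summit.HodgeConjecture.HodgeConjecture.Cruxes.H413.F0P3cDyRamDiagonalOrbitFibreTransport
open Summit.HodgeConjecture.HodgeConjecture.Cruxes.H413.F0P3cDyRamDiagonalOrbitFibreCountHeads
open Summit.HodgeConjecture.HodgeConjecture.Cruxes.H413.F0P3cDyRamDiagonalKappaCountDefs
open Summit.HodgeConjecture.HodgeConjecture.Cruxes.H413.F0P3cDyRamDiagonalKappaCountEval
open Summit.HodgeConjecture.HodgeConjecture.Cruxes.H413.F0P3cDyRamDiagonalKappaOrbitFibreCount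
open scoped Valued WithZero Matrix MatrixGroups

variable {K : Type} [Field K] [Valued K ℤᵐ⁰]

/-! ## §1  The signed orbit-averaging engine -/

/-- **THE SIGNED ORBIT-AVERAGING ENGINE.**  `T = diag(s)` with `s` pairwise-distinct units, finite residue field (so `𝓛₀(T)` is finite, ★ LH4-p12), any `σ`, any `F m : lattices → ℚ`.
IF at every `M₀ ∈ 𝓛₀(T)`: `(Σᶠ_{M ∈ 𝒯·M₀} F M) · [𝒰 : S_F(M₀)] = 8 · [𝒯 : S̃(M₀)] · m(M₀)`, THEN `Σᶠ_{M₀ ∈ 𝓛₀(T)} F M₀ = 8 · Σᶠ_{M₀ ∈ 𝓛₀(T)} m(M₀) · stabiliserWeight σ M₀`.  Proof = ★ (O2c)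
FILE 1 §3 for signed `F` and a multiplicity: ★ §1 averaging with `orb = 𝒯·(·)` (a block system on `𝓛₀(T)`, ★ §2), orbit by orbit `(Σᶠ_{𝒯·M₀} F) ∕ #(𝒯·M₀) = 8·m·[𝒯 : S̃] ∕
([𝒰 : S_F]·[𝒯 : S̃]) = 8 · m(M₀) · stabiliserWeight σ M₀` (★ (O1) `#(𝒯·M₀) = [𝒯 : S̃(M₀)]`, both indices `≠ 0`, ★ §2).  No orbit-invariance of `m` is needed (it is read at the base
point of each averaged term). [cite: Kottwitz1986BaseChangeUnits, §1 pp. 240–241] [cite: Rogawski1990, §4.9 Prop. 4.9.1 (a) p. 55] -/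
theorem finsum_mem_eq_eight_mul_finsum_mul_stabiliserWeight [Finite 𝓀[K]]
    {ϖ : K} (hϖ : Valued.v ϖ = WithZero.exp (-1 : ℤ)) {s : Fin 3 → K} (hs : ∀ i, Valued.v (s i) = 1) (hreg : ∀ i j, i ≠ j → s i ≠ s j)
    (T : GL (Fin 3) K) (hT : (T : Matrix (Fin 3) (Fin 3) K) = Matrix.diagonal s) (σ : K →+* K)
    (F m : Submodule 𝒪[K] (Fin 3 → K) → ℚ)
    (horb : ∀ M₀ ∈ normalisedStableLattices T,
      (∑ᶠ M ∈ {M : Submodule 𝒪[K] (Fin 3 → K) | ∃ u ∈ unitTorus K 3, M = mapGL (diagGLUnits u) M₀}, F M) *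
          (((fixedUnitStabilizer σ M₀).relIndex (fixedUnitTorus σ 3) : ℕ) : ℚ) =
        8 * (((unitStabilizer M₀).relIndex (unitTorus K 3) : ℕ) : ℚ) * m M₀) :
    ∑ᶠ M₀ ∈ normalisedStableLattices T, F M₀ = 8 * ∑ᶠ M₀ ∈ normalisedStableLattices T, m M₀ * stabiliserWeight σ M₀ := by
  classical
  have h𝓛 : (normalisedStableLattices T).Finite := finite_setOf_normalised_diagonal_fixed_latt hϖ s hs hreg T hT
  have hsub : ∀ M₀ ∈ normalisedStableLattices T,
      {M : Submodule 𝒪[K] (Fin 3 → K) | ∃ u ∈ unitTorus K 3, M = mapGL (diagGLUnits u) M₀} ⊆ normalisedStableLattices T :=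
    fun M₀ hM₀ => unitTorus_orbit_subset_normalisedStableLattices T hT hM₀
  have hfinO : ∀ M₀ ∈ normalisedStableLattices T,
      {M : Submodule 𝒪[K] (Fin 3 → K) | ∃ u ∈ unitTorus K 3, M = mapGL (diagGLUnits u) M₀}.Finite :=
    fun M₀ hM₀ => h𝓛.subset (hsub M₀ hM₀)
  rw [finsum_mem_eq_finsum_mem_div_ncard_orbit h𝓛
    (fun M₀ => {M : Submodule 𝒪[K] (Fin 3 → K) | ∃ u ∈ unitTorus K 3, M = mapGL (diagGLUnits u) M₀}) hsub
    (fun M₀ _ => mem_unitTorus_orbit_self M₀) (fun M₀ _ M hM => unitTorus_orbit_eq_of_mem hM) F]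
  -- evaluate the average over each orbit
  have hterm : ∀ M₀ ∈ normalisedStableLattices T,
      (∑ᶠ M ∈ {M : Submodule 𝒪[K] (Fin 3 → K) | ∃ u ∈ unitTorus K 3, M = mapGL (diagGLUnits u) M₀}, F M) /
          (({M : Submodule 𝒪[K] (Fin 3 → K) | ∃ u ∈ unitTorus K 3, M = mapGL (diagGLUnits u) M₀}.ncard : ℕ) : ℚ) =
        8 * (m M₀ * stabiliserWeight σ M₀) := by
    intro M₀ hM₀
    have hn0 : (unitStabilizer M₀).relIndex (unitTorus K 3) ≠ 0 := relIndex_unitStabilizer_ne_zero_of_finite (hfinO M₀ hM₀)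
    have hi0 : (fixedUnitStabilizer σ M₀).relIndex (fixedUnitTorus σ 3) ≠ 0 :=
      relIndex_fixedUnitStabilizer_ne_zero_of_finite σ (hfinO M₀ hM₀)
    have hnq : (((unitStabilizer M₀).relIndex (unitTorus K 3) : ℕ) : ℚ) ≠ 0 := Nat.cast_ne_zero.2 hn0
    have hiq : (((fixedUnitStabilizer σ M₀).relIndex (fixedUnitTorus σ 3) : ℕ) : ℚ) ≠ 0 := Nat.cast_ne_zero.2 hi0
    rw [ncard_unitTorus_orbit_eq_relIndex_unitStabilizer, stabiliserWeight, div_eq_iff hnq,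
      ← mul_right_cancel_iff_of_pos (Nat.cast_pos.2 (Nat.pos_of_ne_zero hi0)), horb M₀ hM₀]
    field_simp
  rw [finsum_mem_congr rfl hterm, finsum_mem_eq_finite_toFinset_sum _ h𝓛, finsum_mem_eq_finite_toFinset_sum _ h𝓛, ← Finset.mul_sum]

/-! ## §2  (Oκ2a): the signed eight-class sum re-indexed over `𝓛₀(T)` -/

/-- **(Oκ2a) THE κ-WEIGHTED EIGHT-CLASS SUM RE-INDEXED BY NORMALISATION.**  Over a `ℤᵐ⁰`-valued field with finite residue field, valuation-preserving `σ`, uniformiser `ϖ` (`ϖu`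
the same element as a unit), a unit `c`, a REGULAR UNIT diagonal `T = diag(s)`, a type `tv` and a slot `i`:
`↑(Σ_e χ⁰_i(e) · #{M : M type-tv for diag(d_e), T·M = M}) = Σᶠ_{M₀ ∈ 𝓛₀(T)} Σ_e χ⁰_i(e) · #{a : diag(ϖu^{a})·M₀ type-tv for diag(d_e)}` in `ℚ` — the left-hand side is the (KMS)
summand block token for token (the inline sign table of the U3 text), cast to `ℚ`; class by class ★ (O2a) `ncard_fixed_vertices_eq_ncard_normalised_pairs` + ★
`ncard_setOf_mem_and_mem_eq_finsum_mem` (all fibres finite: ★ H p855247, ★ `𝓛₀` finite), then `Finset.sum_comm`. [cite: Kottwitz1986BaseChangeUnits, §1 pp. 240–241]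
[cite: Serre1980Trees, II §1.1] [cite: LanglandsShelstad1987, §3] -/
theorem cast_sum_signChar_mul_ncard_fixed_vertices_eq_finsum [Finite 𝓀[K]] {σ : K →+* K}
    (hvσ : ∀ a, Valued.v (σ a) = Valued.v a) {ϖ : K} (hϖ : Valued.v ϖ = WithZero.exp (-1 : ℤ)) (ϖu : Kˣ) (hϖu : (ϖu : K) = ϖ)
    {c : K} (hcv : Valued.v c = 1) {s : Fin 3 → K} (hs : ∀ i, Valued.v (s i) = 1) (hreg : ∀ i j, i ≠ j → s i ≠ s j)
    (T : GL (Fin 3) K) (hT : (T : Matrix (Fin 3) (Fin 3) K) = Matrix.diagonal s) (tv : ℕ) (i : Fin 3) :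
    (((∑ e : Fin 3 → Bool,
        (![(if e 1 then -1 else 1) * (if e 2 then -1 else 1),
           (if e 0 then -1 else 1) * (if e 2 then -1 else 1),
           (if e 0 then -1 else 1) * (if e 1 then -1 else 1)] : Fin 3 → ℤ) i *
          ({M : Submodule 𝒪[K] (Fin 3 → K) |
            IsVertexLattice σ ϖ (Matrix.diagonal fun j => if e j then c else (1 : K)) tv M ∧ mapGL T M = M}.ncard : ℤ) : ℤ) : ℚ)) =
      ∑ᶠ M₀ ∈ normalisedStableLattices T, ∑ e : Fin 3 → Bool, (signChar i e : ℚ) *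
        ((({a : Fin 3 → ℤ | IsVertexLattice σ ϖ (Matrix.diagonal fun j => if e j then c else (1 : K)) tv
            (mapGL (diagGLUnits fun j => ϖu ^ a j) M₀)} : Set _).ncard : ℕ) : ℚ) := by
  classical
  have hd : ∀ (e : Fin 3 → Bool) (j : Fin 3), Valued.v (if e j then c else (1 : K)) = 1 := by
    intro e j; split_ifs
    · exact hcv
    · exact map_one _
  have hs' : ∀ j, Valued.v (s j) ≤ 1 := fun j => (hs j).le
  have hinj : Function.Injective s := fun j j' hjj => by
    by_contra h; exact hreg j j' h hjj
  have h𝓛 : (normalisedStableLattices T).Finite := finite_setOf_normalised_diagonal_fixed_latt hϖ s hs hreg T hT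
  -- the pair sets are finite, class by class, hence so is every fibre
  have hSR : ∀ e : Fin 3 → Bool, {p : Submodule 𝒪[K] (Fin 3 → K) × (Fin 3 → ℤ) | p.1 ∈ normalisedStableLattices T ∧
      IsVertexLattice σ ϖ (Matrix.diagonal fun j => if e j then c else (1 : K)) tv (mapGL (diagGLUnits fun j => ϖu ^ p.2 j) p.1)}.Finite := fun e =>
    finite_normalisedPairs_of_finite_fixed_vertices σ hϖ ϖu hϖu _ tv T hT (finite_setOf_isVertexLattice_mapGL_diagonal_eq hvσ hϖ (hd e) s hs' hinj T hT tv)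
  have hA : ∀ (e : Fin 3 → Bool), ∀ M₀ ∈ normalisedStableLattices T, ({a : Fin 3 → ℤ |
      IsVertexLattice σ ϖ (Matrix.diagonal fun j => if e j then c else (1 : K)) tv (mapGL (diagGLUnits fun j => ϖu ^ a j) M₀)} : Set _).Finite :=
    fun e M₀ hM₀ => ((hSR e).preimage (Prod.mk_right_injective M₀).injOn).subset fun a ha => ⟨hM₀, ha⟩
  -- class by class: ★ (O2a) §2 bijection, then fibrewise count over `𝓛₀(T)`
  have h1 : ∀ e : Fin 3 → Bool, ({M : Submodule 𝒪[K] (Fin 3 → K) |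
        IsVertexLattice σ ϖ (Matrix.diagonal fun j => if e j then c else (1 : K)) tv M ∧ mapGL T M = M}.ncard : ℕ) =
      ∑ M₀ ∈ h𝓛.toFinset, ({a : Fin 3 → ℤ |
        IsVertexLattice σ ϖ (Matrix.diagonal fun j => if e j then c else (1 : K)) tv (mapGL (diagGLUnits fun j => ϖu ^ a j) M₀)} : Set _).ncard := fun e => by
    rw [ncard_fixed_vertices_eq_ncard_normalised_pairs σ hϖ ϖu hϖu _ tv T hT, ← finsum_mem_eq_finite_toFinset_sum _ h𝓛]
    exact ncard_setOf_mem_and_mem_eq_finsum_mem h𝓛 (fun M₀ => ({a : Fin 3 → ℤ |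
      IsVertexLattice σ ϖ (Matrix.diagonal fun j => if e j then c else (1 : K)) tv (mapGL (diagGLUnits fun j => ϖu ^ a j) M₀)} : Set _)) (hA e)
  rw [finsum_mem_eq_finite_toFinset_sum _ h𝓛, Finset.sum_comm]
  push_cast
  refine Finset.sum_congr rfl fun e _ => ?_
  rw [h1 e, Nat.cast_sum, Finset.mul_sum]
  rfl

/-! ## §3  (Oκ2c): the heads -/

/-- **(Oκ2c) THE κ-WEIGHTED ORBIT COUNT, ANY VERTEX TYPE `tv`, UNDER THE ONE-COSET PROPERTY ON `𝓛₀(T)` (B9-0 shape, at every `M₀ ∈ 𝓛₀(T)`).**  For `T = diag(s)` (`s`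
pairwise-distinct units), an isometric involution `σ`, a uniformiser `ϖ = ↑ϖu`, a `σ`-fixed NON-NORM unit `c` with the index-two dichotomy, and a slot `i`:
`↑(Σ_e χ⁰_i(e) · #{M : M type-tv for diag(d_e), T·M = M}) = 8 · Σᶠ_{M₀ ∈ 𝓛₀(T)} kappaCount σ ϖ tv i M₀ · stabiliserWeight σ M₀` over `ℚ` — §2 re-indexing, then §1's engine fed with
(Oκ2b) `sum_signChar_mul_finsum_ncard_fibre_mul_relIndex_eq` at every `M₀` (the finite sum over `e` and the finsum over the orbit commute).  (R-21): the hypothesis holds on all of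
`𝓛₀(T)` at `tv = 0` (next theorem) but NOT at `tv = 2` on the glued strata with `ρ` even. [cite: Kottwitz1986BaseChangeUnits, §1 pp. 240–241] [cite: Rogawski1990, §4.9 Prop. 4.9.1 (a) p. 55]
[cite: LanglandsShelstad1987, §3] -/
theorem cast_sum_signChar_mul_ncard_eq_eight_mul_finsum_kappaCount [Finite 𝓀[K]] {σ : K →+* K} (hσ : ∀ x, σ (σ x) = x)
    (hvσ : ∀ a, Valued.v (σ a) = Valued.v a) {ϖ : K} (hϖ : Valued.v ϖ = WithZero.exp (-1 : ℤ)) (ϖu : Kˣ) (hϖu : (ϖu : K) = ϖ)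
    {c : K} (hσc : σ c = c) (hcv : Valued.v c = 1) (hc : ¬ ∃ z : K, z * σ z = c)
    (hdich : ∀ x : K, σ x = x → x ≠ 0 → (∃ z : K, z * σ z = x) ∨ ∃ z : K, z * σ z = c * x)
    {s : Fin 3 → K} (hs : ∀ i, Valued.v (s i) = 1) (hreg : ∀ i j, i ≠ j → s i ≠ s j)
    (T : GL (Fin 3) K) (hT : (T : Matrix (Fin 3) (Fin 3) K) = Matrix.diagonal s) (tv : ℕ)
    (hcoset : ∀ M₀ ∈ normalisedStableLattices T, ∀ D₁ : Fin 3 → K, (∀ i, σ (D₁ i) = D₁ i ∧ D₁ i ≠ 0) →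
      IsVertexLattice σ ϖ (Matrix.diagonal D₁) tv M₀ → ∀ D : Fin 3 → K, (∀ i, σ (D i) = D i ∧ D i ≠ 0) →
        (IsVertexLattice σ ϖ (Matrix.diagonal D) tv M₀ ↔ ∃ u ∈ fixedUnitStabilizer σ M₀, ∀ i, D i = D₁ i * (u i : Kˣ)))
    (i : Fin 3) :
    (((∑ e : Fin 3 → Bool,
        (![(if e 1 then -1 else 1) * (if e 2 then -1 else 1),
           (if e 0 then -1 else 1) * (if e 2 then -1 else 1),
           (if e 0 then -1 else 1) * (if e 1 then -1 else 1)] : Fin 3 → ℤ) i *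
          ({M : Submodule 𝒪[K] (Fin 3 → K) |
            IsVertexLattice σ ϖ (Matrix.diagonal fun j => if e j then c else (1 : K)) tv M ∧ mapGL T M = M}.ncard : ℤ) : ℤ) : ℚ)) =
      8 * ∑ᶠ M₀ ∈ normalisedStableLattices T, (kappaCount σ ϖ tv i M₀ : ℚ) * stabiliserWeight σ M₀ := by
  classical
  rw [cast_sum_signChar_mul_ncard_fixed_vertices_eq_finsum hvσ hϖ ϖu hϖu hcv hs hreg T hT tv i]
  refine finsum_mem_eq_eight_mul_finsum_mul_stabiliserWeight hϖ hs hreg T hT σ _ _ fun M₀ hM₀ => ?_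
  have hfinO := finite_unitTorus_orbit_of_mem_normalisedStableLattices hϖ hs hreg T hT hM₀
  -- swap the finite sum over `e` with the finsum over the orbit, then (Oκ2b)
  have hswap : (∑ᶠ M ∈ {M : Submodule 𝒪[K] (Fin 3 → K) | ∃ u ∈ unitTorus K 3, M = mapGL (diagGLUnits u) M₀},
      ∑ e : Fin 3 → Bool, (signChar i e : ℚ) *
        ((({a : Fin 3 → ℤ | IsVertexLattice σ ϖ (Matrix.diagonal fun j => if e j then c else (1 : K)) tv
            (mapGL (diagGLUnits fun j => ϖu ^ a j) M)} : Set _).ncard : ℕ) : ℚ)) =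
      ∑ e : Fin 3 → Bool, (signChar i e : ℚ) *
        ((∑ᶠ M ∈ {M : Submodule 𝒪[K] (Fin 3 → K) | ∃ u ∈ unitTorus K 3, M = mapGL (diagGLUnits u) M₀},
          ({a : Fin 3 → ℤ | IsVertexLattice σ ϖ (Matrix.diagonal fun j => if e j then c else (1 : K)) tv
            (mapGL (diagGLUnits fun j => ϖu ^ a j) M)} : Set _).ncard : ℕ) : ℚ) := by
    rw [finsum_mem_eq_finite_toFinset_sum _ hfinO, Finset.sum_comm]
    refine Finset.sum_congr rfl fun e _ => ?_
    rw [finsum_mem_eq_finite_toFinset_sum _ hfinO, Nat.cast_sum, Finset.mul_sum]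
  rw [hswap]
  exact sum_signChar_mul_finsum_ncard_fibre_mul_relIndex_eq hσ hvσ hϖ ϖu hϖu hσc hcv hc hdich hfinO tv (hcoset M₀ hM₀) i

/-- **(Oκ2c)₀ THE κ-WEIGHTED ORBIT COUNT AT TYPE 0, UNCONDITIONALLY — κ-STAGE A OF (KMS) IN THE κ-STAGE-B INPUT CURRENCY.**  Same data, `tv = 0` (the one-coset property is ★
`fibre_isCoset_zero` on every normalised lattice, so no `hcoset`), and the right-hand finsum restricted to the dualisable part (`kappaCount σ ϖ 0 i = 0` off it):
`↑(Σ_e χ⁰_i(e) · #{M : M type-0 for diag(d_e), T·M = M}) = 8 · Σᶠ_{M₀ ∈ {M ∈ 𝓛₀(T) | IsDualisableLattice σ ϖ M}} kappaCount σ ϖ 0 i M₀ · stabiliserWeight σ M₀` over `ℚ` — the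
left-hand side is the `tv = 0` summand block of (KMS) :407 token for token, the right-hand index set is ★ B10's ∕ the union of the ★ `stratum σ ϖ T a`.
[cite: Kottwitz1986BaseChangeUnits, §1 pp. 240–241] [cite: Rogawski1990, §4.9 Prop. 4.9.1 (a) p. 55] [cite: LanglandsShelstad1987, §3] -/
theorem cast_sum_signChar_mul_ncard_eq_eight_mul_finsum_kappaCount_zero [Finite 𝓀[K]] {σ : K →+* K} (hσ : ∀ x, σ (σ x) = x)
    (hvσ : ∀ a, Valued.v (σ a) = Valued.v a) {ϖ : K} (hϖ : Valued.v ϖ = WithZero.exp (-1 : ℤ)) (ϖu : Kˣ) (hϖu : (ϖu : K) = ϖ)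
    {c : K} (hσc : σ c = c) (hcv : Valued.v c = 1) (hc : ¬ ∃ z : K, z * σ z = c)
    (hdich : ∀ x : K, σ x = x → x ≠ 0 → (∃ z : K, z * σ z = x) ∨ ∃ z : K, z * σ z = c * x)
    {s : Fin 3 → K} (hs : ∀ i, Valued.v (s i) = 1) (hreg : ∀ i j, i ≠ j → s i ≠ s j)
    (T : GL (Fin 3) K) (hT : (T : Matrix (Fin 3) (Fin 3) K) = Matrix.diagonal s) (i : Fin 3) :
    (((∑ e : Fin 3 → Bool,
        (![(if e 1 then -1 else 1) * (if e 2 then -1 else 1),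
           (if e 0 then -1 else 1) * (if e 2 then -1 else 1),
           (if e 0 then -1 else 1) * (if e 1 then -1 else 1)] : Fin 3 → ℤ) i *
          ({M : Submodule 𝒪[K] (Fin 3 → K) |
            IsVertexLattice σ ϖ (Matrix.diagonal fun j => if e j then c else (1 : K)) 0 M ∧ mapGL T M = M}.ncard : ℤ) : ℤ) : ℚ)) =
      8 * ∑ᶠ M₀ ∈ {M : Submodule 𝒪[K] (Fin 3 → K) | M ∈ normalisedStableLattices T ∧ IsDualisableLattice σ ϖ M},
        (kappaCount σ ϖ 0 i M₀ : ℚ) * stabiliserWeight σ M₀ := by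
  classical
  have hcoset : ∀ M₀ ∈ normalisedStableLattices T, ∀ D₁ : Fin 3 → K, (∀ i, σ (D₁ i) = D₁ i ∧ D₁ i ≠ 0) →
      IsVertexLattice σ ϖ (Matrix.diagonal D₁) 0 M₀ → ∀ D : Fin 3 → K, (∀ i, σ (D i) = D i ∧ D i ≠ 0) →
        (IsVertexLattice σ ϖ (Matrix.diagonal D) 0 M₀ ↔ ∃ u ∈ fixedUnitStabilizer σ M₀, ∀ i, D i = D₁ i * (u i : Kˣ)) := by
    rintro M₀ ⟨⟨g, hg⟩, -, hnorm⟩ D₁ hD₁ hV₁ D hD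
    exact fibre_isCoset_zero hvσ ϖ g hg hnorm D₁ hD₁ hV₁ D hD
  rw [cast_sum_signChar_mul_ncard_eq_eight_mul_finsum_kappaCount hσ hvσ hϖ ϖu hϖu hσc hcv hc hdich hs hreg T hT 0 hcoset i]
  congr 1
  -- restrict to the dualisable part: `kappaCount σ ϖ 0 i = 0` off it
  have h𝓛 : (normalisedStableLattices T).Finite := finite_setOf_normalised_diagonal_fixed_latt hϖ s hs hreg T hT
  have hset : {M : Submodule 𝒪[K] (Fin 3 → K) | M ∈ normalisedStableLattices T ∧ IsDualisableLattice σ ϖ M} =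
      ↑(h𝓛.toFinset.filter fun M => IsDualisableLattice σ ϖ M) := by
    ext M
    simp only [Set.mem_setOf_eq, Finset.coe_filter, Set.Finite.mem_toFinset]
  rw [hset, finsum_mem_coe_finset, finsum_mem_eq_finite_toFinset_sum _ h𝓛, Finset.sum_filter_of_ne]
  intro M _ hne
  by_contra hdual
  apply hne
  rw [kappaCount_zero_eq_zero_of_not_isDualisableLattice σ ϖ i M hdual, Int.cast_zero, zero_mul]

end Summit.HodgeConjecture.HodgeConjecture.Cruxes.H413.F0P3cDyRamDiagonalKappaOrbitCount

end
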